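import Summits.QuantumFields.GaugeBoot.BootstrapTranslationReductionZd
import HarnessLib

/-!
# Axis permutations on top of translations: the lattice-symmetry-reduced bootstrap on `ℤ^d` (gauge-boot, L1/L4 supplement)

HONEST FRAMING (cell `pub-gaugeboot`, page 1 of every file): the venture produces certified bounds
on lattice expectations at stated coupling, gauge group, dimension and torus size; NOT a mass gap,
NOT a continuum limit, NOT a string tension; NOT Yang–Mills-summit-bearing (barriers
`FixedCouplingUltralocality`, `PerturbativeInvisibility`). Structural; it certifies no number.

## Content (`SU(N)` on `ℤ^d`, word level `n`; the orientation-preserving space group `S_d ⋉ ℤ^d`)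

Kazakov–Zheng reduce the infinite-lattice SDP by the TRANSLATIONS (Wilson loops by shape,
`BootstrapTranslationReductionZd`) and by the lattice POINT GROUP. The point group is finite, so its
Reynolds operator is the finite average `avgFunctional` of `BootstrapSymmetryReduction`; the only
new point on `ℤ^d` is that it must preserve the imposed translation invariance — it does, because
`π_σ ∘ τ_v = τ_{σ v} ∘ π_σ` (`relabelCM_edgeShift_comp_edgePerm`).

* `relabelCM_edgePerm_comp`, `relabelCM_edgeShift_comp_edgePerm`, `relabelCM_edgePerm_eq_relabelConfig`;
  `wilsonBoundaryAction_single_relabelCM_edgePerm` — the one-link Wilson boundary actions are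
  covariant under axis permutations (`LatticeGaugeDLRSymmetry.wilsonBoundaryAction_relabel_edgePerm`);
* ★ `spaceSymLevelValuesZdSuN N β n P` — level-`n` feasible functionals invariant on the words of
  length `≤ 2n` under all translations AND all axis permutations `edgePerm σ`, `σ ∈ S_d`;
  `spaceSym ⊆ sym ⊆ plain`; ★★ SOUNDNESS `dlr_integral_mem_spaceSymLevelValuesZd` for Gibbs
  states invariant under translations and axis permutations;
* `axisAvg P = |S_d|⁻¹ Σ_σ P ∘ π_σ` (`axisAvg_mem_wordTruncation`, `apply_axisAvg_of_invariant`);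
* ★★★ `spaceSymLevelValuesZd_eq_symLevelValuesZd_axisAvg` — for every combination `P` of words of
  length `≤ 2n`, the space-group-reduced level-`n` values of `P` are EXACTLY the translation-reduced
  level-`n` values of its axis average `axisAvg P`; ★★★
  `spaceSymLevelValuesZd_eq_symLevelValuesZd_of_invariant` — for an axis-symmetric objective (e.g.
  the plaquette at the origin averaged over the `d(d-1)/2` planes) the point-group reduction on top
  of the translation reduction is LOSSLESS at every level.

What this is NOT: reflections / the full hyperoctahedral group `B_d` (orientation reversing; at a
fixed level a genuine extra cut, cf. `BootstrapReflectionCutLevels` on the torus) are not covered;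
no block-diagonalisation; no rates.

References: V. Kazakov, Z. Zheng, arXiv:2203.11360 §3.3 (reduction by the lattice symmetry group
`B_3 × ℤ_2`); K. Gatermann, P. A. Parrilo, J. Pure Appl. Algebra 192 (2004) 95, Thm 3.3. Folklore.
-/

noncomputable section

open MeasureTheory Filter Topology NormedSpace
open Literature.MathematicalPhysics.QuantumFieldTheory (LatticeRep)
open Literature.MathematicalPhysics.QuantumLattice

namespace Summit.QuantumFields.GaugeBoot

/-! ## Axis permutations of `ℤ^d` as relabellings -/

section PermZd

variable {d : ℕ} {G : Type*} [Group G] [TopologicalSpace G]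

omit [Group G] in
/-- **Composition of axis permutations**: `π_δ^* ∘ π_γ^* = π_{γδ}^*` on configurations. -/
theorem relabelCM_edgePerm_comp (γ δ : Equiv.Perm (Fin d)) :
    (relabelCM (G := G) (edgePerm δ)).comp (relabelCM (edgePerm γ)) =
      relabelCM (G := G) (edgePerm (γ * δ)) := by
  ext U e
  rfl

omit [Group G] in
/-- **Permutations normalise translations**: `τ_v^* ∘ π_σ^* = π_σ^* ∘ τ_{σ v}^*`
(`π_σ (τ_v e) = τ_{σ v} (π_σ e)`). -/
theorem relabelCM_edgeShift_comp_edgePerm (v : Fin d → ℤ) (σ : Equiv.Perm (Fin d)) :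
    (relabelCM (G := G) (edgeShift v)).comp (relabelCM (edgePerm σ)) =
      (relabelCM (G := G) (edgePerm σ)).comp (relabelCM (edgeShift (sitePerm σ v))) := by
  ext U e
  simp only [ContinuousMap.comp_apply, relabelCM_apply, Literature.MathematicalPhysics.QuantumLattice.edgePerm_apply, edgeShift_apply,
    Literature.MathematicalPhysics.QuantumLattice.sitePerm_add]

omit [Group G] in
/-- The relabelling by `edgePerm σ` is `relabelConfig (edgePerm σ⁻¹)` of `LatticeGaugeDLRSymmetry`. -/
theorem relabelCM_edgePerm_eq_relabelConfig [MeasurableSpace G] (σ : Equiv.Perm (Fin d)) (U : LGConfig d G) :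
    relabelCM (G := G) (edgePerm σ) U = relabelConfig (edgePerm σ⁻¹) U := by
  funext e
  rfl

omit [Group G] [TopologicalSpace G] in
/-- `edgePerm σ⁻¹` undoes `edgePerm σ` (`edgePerm σ⁻¹ = (edgePerm σ)⁻¹` definitionally). -/
theorem edgePerm_inv_apply_edgePerm (σ : Equiv.Perm (Fin d)) (e : ZdEdge d) :
    edgePerm σ⁻¹ (edgePerm σ e) = e :=
  (edgePerm σ).symm_apply_apply e

/-- **The one-link Wilson boundary actions are covariant under axis permutations**:
`S_e (U ∘ π_σ) = S_{π_σ e} U` (continuous `ρ` of a compact group: a re-ordered plaquette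
contributes `Re tr ρ(U_p⁻¹) = Re tr ρ(U_p)`). -/
theorem wilsonBoundaryAction_single_relabelCM_edgePerm [MeasurableSpace G] [IsTopologicalGroup G]
    [CompactSpace G] {N : ℕ} (ρ : G →* Matrix (Fin N) (Fin N) ℂ) (hρ : Continuous ρ)
    (σ : Equiv.Perm (Fin d)) (e : ZdEdge d) (U : LGConfig d G) :
    wilsonBoundaryAction ρ {e} (relabelCM (G := G) (edgePerm σ) U) =
      wilsonBoundaryAction ρ {edgePerm σ e} U := by
  have hΛ : ({e} : Finset (ZdEdge d)) = ({edgePerm σ e} : Finset (ZdEdge d)).map (edgePerm σ⁻¹).toEmbedding := by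
    rw [Finset.map_singleton, Equiv.toEmbedding_apply, edgePerm_inv_apply_edgePerm]
  rw [relabelCM_edgePerm_eq_relabelConfig, hΛ]
  exact wilsonBoundaryAction_relabel_edgePerm ρ hρ σ⁻¹ {edgePerm σ e} U

variable (r : LatticeRep G)

/-- The word truncation is stable under axis permutations. -/
theorem comp_relabelCM_edgePerm_mem_wordTruncation (n : ℕ) (σ : Equiv.Perm (Fin d))
    {x : C(LGConfig d G, ℝ)} (hx : x ∈ wordTruncation (ι := ZdEdge d) r n) :
    x.comp (relabelCM (G := G) (edgePerm σ)) ∈ wordTruncation (ι := ZdEdge d) r n :=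
  comp_relabelCM_mem_wordTruncation r _ hx

end PermZd

/-! ## The axis average of an observable -/

section AxisAvg

variable {d : ℕ} {G : Type*} [Group G] [TopologicalSpace G] (r : LatticeRep G)

/-- **The axis average** `|S_d|⁻¹ Σ_σ P ∘ π_σ` of an observable over the axis permutations. [folklore] -/
def axisAvg (P : C(LGConfig d G, ℝ)) : C(LGConfig d G, ℝ) :=
  (Fintype.card (Equiv.Perm (Fin d)) : ℝ)⁻¹ • ∑ σ : Equiv.Perm (Fin d), P.comp (relabelCM (G := G) (edgePerm σ))

omit [Group G] in
/-- The axis average is axis invariant. -/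
theorem axisAvg_comp_edgePerm (P : C(LGConfig d G, ℝ)) (δ : Equiv.Perm (Fin d)) :
    (axisAvg P).comp (relabelCM (G := G) (edgePerm δ)) = axisAvg P := by
  change (ContinuousMap.compRightAlgHom ℝ ℝ (relabelCM (G := G) (edgePerm δ))) (axisAvg P) = axisAvg P
  simp only [axisAvg, map_smul, map_sum]
  congr 1
  have h : ∀ σ : Equiv.Perm (Fin d),
      (ContinuousMap.compRightAlgHom ℝ ℝ (relabelCM (G := G) (edgePerm δ))) (P.comp (relabelCM (edgePerm σ))) =
        P.comp (relabelCM (G := G) (edgePerm (δ * σ))) := fun σ => by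
    change (P.comp (relabelCM (edgePerm σ))).comp (relabelCM (G := G) (edgePerm δ)) = _
    rw [ContinuousMap.comp_assoc, relabelCM_edgePerm_comp]
  simp only [h]
  exact Fintype.sum_equiv (Equiv.mulLeft δ) _ _ fun σ => rfl

/-- The axis average of a combination of words of length `≤ n` is one. -/
theorem axisAvg_mem_wordTruncation {n : ℕ} {P : C(LGConfig d G, ℝ)}
    (hP : P ∈ wordTruncation (ι := ZdEdge d) r n) : axisAvg P ∈ wordTruncation (ι := ZdEdge d) r n := by
  unfold axisAvg wordTruncation
  refine Submodule.smul_mem _ _ (Submodule.sum_mem _ fun σ _ => ?_)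
  exact comp_relabelCM_edgePerm_mem_wordTruncation r n σ hP

omit [Group G] in
/-- **An axis-invariant functional gives the axis average the value of the observable.** -/
theorem apply_axisAvg_of_invariant (φ : C(LGConfig d G, ℝ) →ₗ[ℝ] ℝ) {P : C(LGConfig d G, ℝ)}
    (h : ∀ σ : Equiv.Perm (Fin d), φ (P.comp (relabelCM (G := G) (edgePerm σ))) = φ P) :
    φ (axisAvg P) = φ P := by
  simp only [axisAvg, map_smul, map_sum, h, Finset.sum_const, Finset.card_univ, nsmul_eq_mul,
    smul_eq_mul]
  have hc : (Fintype.card (Equiv.Perm (Fin d)) : ℝ) ≠ 0 := Nat.cast_ne_zero.2 Fintype.card_ne_zero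
  field_simp

omit [Group G] in
/-- An axis-invariant observable is its own axis average. -/
theorem axisAvg_eq_self_of_invariant {P : C(LGConfig d G, ℝ)}
    (h : ∀ σ : Equiv.Perm (Fin d), P.comp (relabelCM (G := G) (edgePerm σ)) = P) : axisAvg P = P := by
  simp only [axisAvg, h, Finset.sum_const, Finset.card_univ, ← Nat.cast_smul_eq_nsmul ℝ, smul_smul]
  have hc : (Fintype.card (Equiv.Perm (Fin d)) : ℝ) ≠ 0 := Nat.cast_ne_zero.2 Fintype.card_ne_zero
  rw [inv_mul_cancel₀ hc, one_smul]

omit [Group G] in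
/-- **The point-group average of a functional, evaluated**: `avg φ P = φ (axisAvg P)`. -/
theorem avgFunctional_edgePerm_apply (φ : C(LGConfig d G, ℝ) →ₗ[ℝ] ℝ) (P : C(LGConfig d G, ℝ)) :
    avgFunctional (fun σ : Equiv.Perm (Fin d) => relabelCM (G := G) (edgePerm σ)) φ P = φ (axisAvg P) := by
  rw [avgFunctional_apply, axisAvg, map_smul, map_sum, smul_eq_mul]

end AxisAvg

/-! ## `SU(N)` on `ℤ^d`: the space-group-reduced SDP -/

section ZdSuN

variable {d : ℕ} (N : ℕ) (β : ℝ)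

/-- ★ **The lattice-symmetry-reduced level-`n` SDP on `ℤ^d`** (orientation-preserving space
group): level-`n` feasible functionals invariant on the words of length `≤ 2n` under all
translations AND all axis permutations. [folklore] -/
def spaceSymLevelValuesZdSuN (n : ℕ) (P : C(LGConfig d (Matrix.specialUnitaryGroup (Fin N) ℂ), ℝ)) : Set ℝ :=
  {t | ∃ φ : C(LGConfig d (Matrix.specialUnitaryGroup (Fin N) ℂ), ℝ) →ₗ[ℝ] ℝ,
    IsBootstrapFeasible (fundamentalLatticeRep N) (suExp N)
        (fun e => wilsonBoundaryAction (fundamentalRep (Fin N)) {e}) β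
        (wordTruncation (ι := ZdEdge d) (fundamentalLatticeRep N) n) φ ∧
      (∀ (v : Fin d → ℤ), ∀ x ∈ wordTruncation (ι := ZdEdge d) (fundamentalLatticeRep N) (n + n),
        φ (x.comp (relabelCM (G := Matrix.specialUnitaryGroup (Fin N) ℂ) (edgeShift v))) = φ x) ∧
      (∀ (σ : Equiv.Perm (Fin d)), ∀ x ∈ wordTruncation (ι := ZdEdge d) (fundamentalLatticeRep N) (n + n),
        φ (x.comp (relabelCM (G := Matrix.specialUnitaryGroup (Fin N) ℂ) (edgePerm σ))) = φ x) ∧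
      φ P = t}

/-- The one-link Wilson boundary actions of `SU(N)` are covariant under axis permutations. -/
theorem wilsonBoundaryAction_permCovariant_suN (σ : Equiv.Perm (Fin d)) (e : ZdEdge d)
    (U : LGConfig d (Matrix.specialUnitaryGroup (Fin N) ℂ)) :
    (fun e => wilsonBoundaryAction (fundamentalRep (Fin N)) {e}) e
        (relabelCM (G := Matrix.specialUnitaryGroup (Fin N) ℂ) (edgePerm σ) U) =
      (fun e => wilsonBoundaryAction (fundamentalRep (Fin N)) {e}) (edgePerm σ e) U :=
  wilsonBoundaryAction_single_relabelCM_edgePerm (fundamentalRep (Fin N)) (continuous_fundamentalRep _) σ e U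

/-- Imposing the point group as well shrinks the feasible set further. -/
theorem spaceSymLevelValuesZd_subset_symLevelValuesZd (n : ℕ)
    (P : C(LGConfig d (Matrix.specialUnitaryGroup (Fin N) ℂ), ℝ)) :
    spaceSymLevelValuesZdSuN (d := d) N β n P ⊆ symLevelValuesZdSuN (d := d) N β n P := by
  rintro t ⟨φ, hφ, hT, -, rfl⟩
  exact ⟨φ, hφ, hT, rfl⟩

/-- ★★ **Soundness for the fully symmetric phases**: a Gibbs state invariant under translations and
axis permutations is space-group-reduced feasible at every level. [folklore] -/
theorem dlr_integral_mem_spaceSymLevelValuesZd (n : ℕ)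
    {μ : Measure (LGConfig d (Matrix.specialUnitaryGroup (Fin N) ℂ))}
    (hμ : μ ∈ ymGibbsMeasures (d := d) (fundamentalRep (Fin N)) β) (hT : IsZdTranslationInvariant μ)
    (hperm : ∀ σ : Equiv.Perm (Fin d),
      μ.map (relabelConfig (edgePerm σ)) = μ)
    (P : C(LGConfig d (Matrix.specialUnitaryGroup (Fin N) ℂ), ℝ)) :
    ∫ U, P U ∂μ ∈ spaceSymLevelValuesZdSuN (d := d) N β n P := by
  obtain ⟨φ, hφ, hinv, hφP⟩ := dlr_integral_mem_symLevelValuesZd N β n hμ hT P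
  haveI := hμ.1
  -- the witness of `dlr_integral_mem_symLevelValuesZd` is not exposed; rebuild it
  refine ⟨expectationFunctional μ, isBootstrapFeasible_dlr_suN N β hμ (wordTruncation_subset_polyAlgebra _ n),
    fun v x _ => ?_, fun σ x _ => ?_, rfl⟩
  · rw [expectationFunctional_apply, expectationFunctional_apply]
    have hmp : MeasurePreserving (configShift (G := Matrix.specialUnitaryGroup (Fin N) ℂ) (-v)) μ μ :=
      ⟨(configShift _).measurable, hT (-v)⟩
    have h := hmp.integral_comp (configShift (-v)).measurableEmbedding (fun U => x U)
    simp only [ContinuousMap.comp_apply, relabelCM_edgeShift_eq_configShift]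
    exact h
  · rw [expectationFunctional_apply, expectationFunctional_apply]
    have hmp : MeasurePreserving
        (relabelConfig (G := Matrix.specialUnitaryGroup (Fin N) ℂ) (edgePerm σ⁻¹)) μ μ :=
      ⟨(relabelConfig _).measurable, hperm σ⁻¹⟩
    have h := hmp.integral_comp (relabelConfig (edgePerm σ⁻¹)).measurableEmbedding (fun U => x U)
    simp only [ContinuousMap.comp_apply, relabelCM_edgePerm_eq_relabelConfig]
    exact h

/-- ★★★ **The space-group-reduced values of `P` are the translation-reduced values of its axis
average** (`P` a combination of words of length `≤ 2n`): adding the point group to the translation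
reduction replaces the objective by `axisAvg P` and costs nothing else. The finite point-group
average of a translation-invariant solution is translation invariant because permutations
normalise translations. [cite: GatermannParrilo2004, Thm 3.3] -/
theorem spaceSymLevelValuesZd_eq_symLevelValuesZd_axisAvg {n : ℕ}
    {P : C(LGConfig d (Matrix.specialUnitaryGroup (Fin N) ℂ), ℝ)}
    (hP : P ∈ wordTruncation (ι := ZdEdge d) (fundamentalLatticeRep N) (n + n)) :
    spaceSymLevelValuesZdSuN (d := d) N β n P = symLevelValuesZdSuN (d := d) N β n (axisAvg P) := by
  ext t
  constructor
  · rintro ⟨φ, hφ, hT, hperm, rfl⟩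
    exact ⟨φ, hφ, hT, apply_axisAvg_of_invariant φ fun σ => hperm σ P hP⟩
  · rintro ⟨ψ, hψ, hT, rfl⟩
    set R : Equiv.Perm (Fin d) → C(LGConfig d (Matrix.specialUnitaryGroup (Fin N) ℂ),
        LGConfig d (Matrix.specialUnitaryGroup (Fin N) ℂ)) :=
      fun σ => relabelCM (G := Matrix.specialUnitaryGroup (Fin N) ℂ) (edgePerm σ) with hRdef
    have hR : ∀ δ, ∃ g : Equiv.Perm (Fin d) ≃ Equiv.Perm (Fin d), ∀ γ, (R δ).comp (R γ) = R (g γ) :=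
      fun δ => ⟨Equiv.mulRight δ, fun γ => by
        simp only [hRdef, Equiv.coe_mulRight]
        exact relabelCM_edgePerm_comp γ δ⟩
    have hfeas : ∀ σ, IsBootstrapFeasible (fundamentalLatticeRep N) (suExp N)
        (fun e => wilsonBoundaryAction (fundamentalRep (Fin N)) {e}) β
        (wordTruncation (ι := ZdEdge d) (fundamentalLatticeRep N) n)
        (ψ ∘ₗ (ContinuousMap.compRightAlgHom ℝ ℝ (R σ)).toLinearMap) := fun σ =>
      hψ.comp_relabel (fundamentalLatticeRep N) (edgePerm σ) (wilsonBoundaryAction_permCovariant_suN N σ)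
        (fun v hv => comp_relabelCM_edgePerm_mem_wordTruncation (fundamentalLatticeRep N) n σ hv)
    refine ⟨avgFunctional R ψ, isBootstrapFeasible_avgFunctional (fundamentalLatticeRep N) R hfeas,
      fun v x hx => ?_, fun δ x _ => avgFunctional_comp_eq R hR ψ δ x, ?_⟩
    · -- translation invariance survives the point-group average
      rw [avgFunctional_apply, avgFunctional_apply]
      congr 1
      refine Finset.sum_congr rfl fun σ _ => ?_
      have hc : (x.comp (relabelCM (G := Matrix.specialUnitaryGroup (Fin N) ℂ) (edgeShift v))).comp (R σ) =
          (x.comp (R σ)).comp (relabelCM (G := Matrix.specialUnitaryGroup (Fin N) ℂ) (edgeShift (sitePerm σ v))) := by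
        simp only [hRdef]
        rw [ContinuousMap.comp_assoc, ContinuousMap.comp_assoc, relabelCM_edgeShift_comp_edgePerm]
      rw [hc]
      exact hT (sitePerm σ v) _ (comp_relabelCM_edgePerm_mem_wordTruncation (fundamentalLatticeRep N) _ σ hx)
    · exact avgFunctional_edgePerm_apply ψ P

/-- ★★★ **For an axis-symmetric objective the point-group reduction on top of the translation
reduction is lossless**: `spaceSym_n(P) = sym_n(P)` whenever `P ∘ π_σ = P` for all `σ` (e.g. the
plaquette averaged over the planes through the origin). [cite: GatermannParrilo2004, Thm 3.3] -/
theorem spaceSymLevelValuesZd_eq_symLevelValuesZd_of_invariant {n : ℕ}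
    {P : C(LGConfig d (Matrix.specialUnitaryGroup (Fin N) ℂ), ℝ)}
    (hP : P ∈ wordTruncation (ι := ZdEdge d) (fundamentalLatticeRep N) (n + n))
    (hinv : ∀ σ : Equiv.Perm (Fin d), P.comp (relabelCM (G := Matrix.specialUnitaryGroup (Fin N) ℂ) (edgePerm σ)) = P) :
    spaceSymLevelValuesZdSuN (d := d) N β n P = symLevelValuesZdSuN (d := d) N β n P := by
  rw [spaceSymLevelValuesZd_eq_symLevelValuesZd_axisAvg N β hP, axisAvg_eq_self_of_invariant hinv]

/-- **Corollary: identical optimal values** for axis-symmetric objectives. -/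
theorem sSup_spaceSymLevelValuesZd_eq_of_invariant {n : ℕ}
    {P : C(LGConfig d (Matrix.specialUnitaryGroup (Fin N) ℂ), ℝ)}
    (hP : P ∈ wordTruncation (ι := ZdEdge d) (fundamentalLatticeRep N) (n + n))
    (hinv : ∀ σ : Equiv.Perm (Fin d), P.comp (relabelCM (G := Matrix.specialUnitaryGroup (Fin N) ℂ) (edgePerm σ)) = P) :
    sSup (spaceSymLevelValuesZdSuN (d := d) N β n P) = sSup (symLevelValuesZdSuN (d := d) N β n P) ∧
      sInf (spaceSymLevelValuesZdSuN (d := d) N β n P) = sInf (symLevelValuesZdSuN (d := d) N β n P) := by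
  rw [spaceSymLevelValuesZd_eq_symLevelValuesZd_of_invariant N β hP hinv]
  exact ⟨rfl, rfl⟩

/-- ★★ **The space-group-reduced SDP is feasible at every level** (average the Reynolds image of a
DLR state). -/
theorem spaceSymLevelValuesZd_nonempty (n : ℕ)
    {P : C(LGConfig d (Matrix.specialUnitaryGroup (Fin N) ℂ), ℝ)}
    (hP : P ∈ wordTruncation (ι := ZdEdge d) (fundamentalLatticeRep N) (n + n)) :
    (spaceSymLevelValuesZdSuN (d := d) N β n P).Nonempty := by
  rw [spaceSymLevelValuesZd_eq_symLevelValuesZd_axisAvg N β hP]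
  exact symLevelValuesZd_nonempty N β n _

end ZdSuN

end Summit.QuantumFields.GaugeBoot

end
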